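import Literature.NumberTheory.Automorphic.AdicCompletionDegreeOnePlaceProofs
import Literature.NumberTheory.Automorphic.GaloisActionPlaces
import Mathlib.NumberTheory.RamificationInertia.Galois
import Mathlib.RingTheory.IsGaloisGroup.Basic
import Mathlib.Topology.Algebra.ContinuousMonoidHom
import Mathlib.Topology.MetricSpace.Isometry
import HarnessLib

/-!
# The completion at a place of degree one, as a named isomorphism of topological fields
# `F_v ≃+* K_w`, `F_vˣ ≃ₜ* K_wˣ`; split places of a quadratic extension have degree one

Topic `NumberTheory/Automorphic`; namespace `Literature.NumberTheory.Automorphic` (that of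
`AdeleBaseChange` / `AdicCompletionDegreeOnePlaceProofs`, whose local base-change map
`ι = adicCompletionOfLiesOver F K v w : F_v →+* K_w` (`w ∣ v`) this file packages). Setting: `K/F`
number fields, `w` a finite place of `K` above the finite place `v` of `F`
(`[w.asIdeal.LiesOver v.asIdeal]`), of DEGREE ONE: `e(w|v) = 1`
(`w.asIdeal.ramificationIdx (𝓞 F) = 1`) and `f(w|v) = 1` (`w.asIdeal.inertiaDeg (𝓞 F) = 1`).
The sibling proof file shows that `ι` is then
onto (`surjective_adicCompletionOfLiesOver`) and valuation-preserving, and records the isomorphism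
as an EXISTENCE statement (`exists_ringEquiv_adicCompletion_…`). Consumers computing with local
factors need the isomorphism as a NAMED object together with its metric and topological
properties; this file supplies them (definitions, hence a separate file — D-0014):

* §1 `‖ι y‖ = ‖y‖` (`norm_adicCompletionOfLiesOver_of_degree_one`: `e = 1` gives `v_w ∘ ι = v_v`,
  `f = 1` gives equal residue cardinalities `q_w = q_v`, `absNorm_eq_absNorm_of_inertiaDeg_eq_one`),
  so `ι` is an isometry and a closed embedding (`isometry_…`, `isClosedEmbedding_…`);
* §2 **`adicCompletionEquivOfDegreeOne F K v w he hf : F_v ≃+* K_w`** (`RingEquiv.ofBijective ι`),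
  extending `F → K` (`_coe`), a homeomorphism
  (`isHomeomorph_adicCompletionOfLiesOver_of_degree_one`,
  `adicCompletionHomeomorphOfDegreeOne : F_v ≃ₜ K_w`,
  `continuous_adicCompletionEquivOfDegreeOne_symm`),
  preserving `Valued.v` and `‖·‖` in both directions, and mapping `𝒪_v` onto `𝒪_w`
  (`mem_adicCompletionIntegers_iff_of_degree_one`);
* §3 **`unitsAdicCompletionEquivOfDegreeOne F K v w he hf : F_vˣ ≃ₜ* K_wˣ`** (`Units.mapEquiv`,
  both directions continuous for the unit topologies), with `v_w (e u) = 1 ↔ v_v u = 1`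
  (`valued_unitsAdicCompletionEquivOfDegreeOne_eq_one_iff`: unit groups `𝒪_vˣ ↔ 𝒪_wˣ` correspond);
* §4 the source of degree-one places used in practice: **in a quadratic extension `E/F`, a finite
  place `w` moved by an `F`-automorphism (`c • w ≠ w`, i.e. `v = w ∩ 𝓞 F` SPLITS) has
  `e(w|v) = f(w|v) = 1`** (`ramificationIdx_eq_one_and_inertiaDeg_eq_one_of_smul_ne`): the
  fundamental identity in Galois form `#{𝔓 ∣ v} · e · f = #Aut(E/F) = 2` (Mathlib
  `Ideal.ncard_primesOver_mul_ramificationIdxIn_mul_inertiaDegIn`) with the two distinct primes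
  `w ≠ c • w` above `v` (tree `HeightOneSpectrum.under_algEquiv_smul`); hence `q_w = q_v`
  (`absNorm_eq_absNorm_under_of_smul_ne`).

Everything is proved (Mathlib + tree); the local degree formula `[K_w : F_v] = e f` in general
degree is NOT here (Mathlib has no finite-place local degree yet). Standard: Fröhlich–Taylor,
*Algebraic number theory* (1990), Ch. III §1: (1.14)(a) "`ef = (L:K)`" for complete `K` (so
`e = f = 1` means `L_𝔓 = K_𝔭`), Theorem 19 (the Galois group permutes the primes above `𝔭`
transitively) and Theorem 20 "`(L:K) = ∑ eᵢ fᵢ`; if `L/K` is Galois … `(L:K) = efg`" — verified on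
the held copy [corpus: book:frohlich1990-algebraic-number-theory, chunks p0103 L23–27, p0107–p0108
L17–19]. [folklore]

Novelty check (`lean search --decl`, 2026-08-18): the tree has `adicCompletionOfLiesOver` and the
`Proofs` sibling (surjectivity, `∃ φ : F_v ≃+* K_w`), `UnitaryGroupSplitPlace` §1 (the fibre above a
split place of a quadratic extension has two elements) and `FrobeniusPlaces`
(`q_w = q_v ^ f`, prime-degree dichotomy at UNRAMIFIED `v`); none of the named equivalences, the
isometry / homeomorphism statements, the units version, or the `c • w ≠ w ⇒ e = f = 1` criterion.
Summits-side, the `Langlands` Theorems file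
`NonParallelVoidTensorSquareParallelStubTensorLocalPlumbing.lean` proves
`bijective_adicCompletionOfLiesOver_of_degree_one` and the continuity of
`(RingEquiv.ofBijective ι _).symm` ad hoc for its own use (same statements; a Theorems file is not
importable from Literature) — the present file is their Literature-level home.

## Provenance

Written for the tree under the LEAN-IN-TREE rule (2026-08-18): the Mathlib-and-tree-only content of
the pub-hodgecm cell's package file `HodgeCM/PerL34/LocTorusSplitBase.lean` (DAG-node prover #07
lineage, seat pv07 gen 3, gate run 27; §1, §2, §4a there), restated over the tree's degree-one
hypotheses `e = 1`, `f = 1` and `adicCompletionOfLiesOver` (the package argued from an automorphism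
pair and re-proved surjectivity; here surjectivity is the tree's
`surjective_adicCompletionOfLiesOver`); port by seat pv07 gen 6. Nothing in this file is a claim
of the manuscripts adjudicated by that cell.

## References

* A. Fröhlich, M. J. Taylor, *Algebraic number theory*, Cambridge Studies in Advanced
  Mathematics 27 (1990/1993), Ch. III §1, (1.14)(a), Theorems 19–20. [FrohlichTaylor1990]
-/

set_option autoImplicit false

noncomputable section

open IsDedekindDomain NumberField _root_.Topology

namespace Literature.NumberTheory.Automorphic

section DegreeOne

variable (F K : Type*) [Field F] [NumberField F] [Field K] [NumberField K] [Algebra F K]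
variable (v : HeightOneSpectrum (𝓞 F)) (w : HeightOneSpectrum (𝓞 K))
  [hw : w.asIdeal.LiesOver v.asIdeal]

/-! ### §1 Norms: `‖ι y‖ = ‖y‖` at a place of degree one -/

omit [NumberField K] in
/-- **Equal residue cardinalities at a place of residue degree one**: `q_w = #(𝓞 K ⧸ w) =
#(𝓞 F ⧸ v) = q_v` when `f(w|v) = 1` (Mathlib `Ideal.absNorm_eq_pow_inertiaDeg'_of_liesOver`:
`q_w = q_v ^ f`). [folklore] -/
theorem absNorm_eq_absNorm_of_inertiaDeg_eq_one [NumberField K]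
    (hf : w.asIdeal.inertiaDeg (𝓞 F) = 1) :
    Ideal.absNorm w.asIdeal = Ideal.absNorm v.asIdeal := by
  haveI : v.asIdeal.IsMaximal := v.isMaximal
  haveI : w.asIdeal.IsMaximal := w.isMaximal
  rw [Ideal.absNorm_eq_pow_inertiaDeg'_of_liesOver w.asIdeal v.asIdeal v.isPrime v.ne_bot,
    Ideal.inertiaDeg'_eq_inertiaDeg v.asIdeal w.asIdeal, hf, pow_one]

omit hw in
/-- `WithZeroMulInt.toNNReal` depends only on the base, not on the proof that it is non-zero
(rewriting lemma for equal bases). [folklore] -/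
private theorem toNNReal_congr_base {b b' : NNReal} (h : b = b') (hb : b ≠ 0) (hb' : b' ≠ 0)
    (x : WithZero (Multiplicative ℤ)) :
    WithZeroMulInt.toNNReal hb x = WithZeroMulInt.toNNReal hb' x := by
  subst h; rfl

/-- **`ι : F_v → K_w` preserves norms at a place of degree one**: `‖ι y‖ = ‖y‖` (`e = 1`:
`v_w (ι y) = v_v y`; `f = 1`: the bases `q_w = q_v` of `‖·‖ = q^{-v(·)}` agree). [folklore] -/
theorem norm_adicCompletionOfLiesOver_of_degree_one
    (he : w.asIdeal.ramificationIdx (𝓞 F) = 1) (hf : w.asIdeal.inertiaDeg (𝓞 F) = 1)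
    (y : v.adicCompletion F) :
    ‖adicCompletionOfLiesOver F K v w y‖ = ‖y‖ := by
  rw [FinitePlace.norm_def, FinitePlace.norm_def,
    valued_adicCompletionOfLiesOver_of_ramificationIdx_eq_one F K v w he]
  have hb : (Ideal.absNorm w.asIdeal : NNReal) = (Ideal.absNorm v.asIdeal : NNReal) := by
    exact_mod_cast absNorm_eq_absNorm_of_inertiaDeg_eq_one F K v w hf
  rw [toNNReal_congr_base hb]

/-- `ι` is an isometry at a place of degree one. [folklore] -/
theorem isometry_adicCompletionOfLiesOver_of_degree_one
    (he : w.asIdeal.ramificationIdx (𝓞 F) = 1) (hf : w.asIdeal.inertiaDeg (𝓞 F) = 1) :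
    Isometry (adicCompletionOfLiesOver F K v w) :=
  AddMonoidHomClass.isometry_of_norm _ (norm_adicCompletionOfLiesOver_of_degree_one F K v w he hf)

/-- `ι` is a closed embedding at a place of degree one (an isometry out of a complete space).
[folklore] -/
theorem isClosedEmbedding_adicCompletionOfLiesOver_of_degree_one
    (he : w.asIdeal.ramificationIdx (𝓞 F) = 1) (hf : w.asIdeal.inertiaDeg (𝓞 F) = 1) :
    IsClosedEmbedding (adicCompletionOfLiesOver F K v w) :=
  (isometry_adicCompletionOfLiesOver_of_degree_one F K v w he hf).isClosedEmbedding

/-- `ι` is bijective at a place of degree one (tree `surjective_adicCompletionOfLiesOver`).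
[folklore] -/
theorem bijective_adicCompletionOfLiesOver_of_degree_one
    (he : w.asIdeal.ramificationIdx (𝓞 F) = 1) (hf : w.asIdeal.inertiaDeg (𝓞 F) = 1) :
    Function.Bijective (adicCompletionOfLiesOver F K v w) :=
  ⟨(adicCompletionOfLiesOver F K v w).injective, surjective_adicCompletionOfLiesOver F K v w he hf⟩

/-! ### §2 The named isomorphism `F_v ≃+* K_w` and homeomorphism `F_v ≃ₜ K_w` -/

/-- **`F_v ≃+* K_w` at a place of degree one** (`e(w|v) = f(w|v) = 1`): the local base-change map
`ι`, bijective — the case `[K_w : F_v] = e f = 1` of the local degree formula (Fröhlich–Taylor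
III §1 (1.14)(a)), as a named ring isomorphism. [cite: FrohlichTaylor1990, Ch. III §1 (1.14)(a)] -/
def adicCompletionEquivOfDegreeOne
    (he : w.asIdeal.ramificationIdx (𝓞 F) = 1) (hf : w.asIdeal.inertiaDeg (𝓞 F) = 1) :
    v.adicCompletion F ≃+* w.adicCompletion K :=
  RingEquiv.ofBijective (adicCompletionOfLiesOver F K v w)
    (bijective_adicCompletionOfLiesOver_of_degree_one F K v w he hf)

/-- `adicCompletionEquivOfDegreeOne` is `ι` as a function (definitional). [folklore] -/
@[simp] theorem adicCompletionEquivOfDegreeOne_apply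
    (he : w.asIdeal.ramificationIdx (𝓞 F) = 1) (hf : w.asIdeal.inertiaDeg (𝓞 F) = 1)
    (y : v.adicCompletion F) :
    adicCompletionEquivOfDegreeOne F K v w he hf y = adicCompletionOfLiesOver F K v w y := rfl

/-- `adicCompletionEquivOfDegreeOne` extends `F → K`. [folklore] -/
theorem adicCompletionEquivOfDegreeOne_coe
    (he : w.asIdeal.ramificationIdx (𝓞 F) = 1) (hf : w.asIdeal.inertiaDeg (𝓞 F) = 1) (x : F) :
    adicCompletionEquivOfDegreeOne F K v w he hf (x : v.adicCompletion F) =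
      ((algebraMap F K x : K) : w.adicCompletion K) :=
  adicCompletionOfLiesOver_coe F K v w x

/-- `ι` is a homeomorphism at a place of degree one (a surjective closed embedding). [folklore] -/
theorem isHomeomorph_adicCompletionOfLiesOver_of_degree_one
    (he : w.asIdeal.ramificationIdx (𝓞 F) = 1) (hf : w.asIdeal.inertiaDeg (𝓞 F) = 1) :
    IsHomeomorph (adicCompletionOfLiesOver F K v w) :=
  isHomeomorph_iff_isEmbedding_surjective.2
    ⟨(isClosedEmbedding_adicCompletionOfLiesOver_of_degree_one F K v w he hf).isEmbedding,
      surjective_adicCompletionOfLiesOver F K v w he hf⟩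

/-- **`F_v ≃ₜ K_w`** at a place of degree one. [folklore] -/
def adicCompletionHomeomorphOfDegreeOne
    (he : w.asIdeal.ramificationIdx (𝓞 F) = 1) (hf : w.asIdeal.inertiaDeg (𝓞 F) = 1) :
    v.adicCompletion F ≃ₜ w.adicCompletion K :=
  (isHomeomorph_adicCompletionOfLiesOver_of_degree_one F K v w he hf).homeomorph
    (adicCompletionOfLiesOver F K v w)

/-- `adicCompletionHomeomorphOfDegreeOne` is `ι` as a function (definitional). [folklore] -/
@[simp] theorem adicCompletionHomeomorphOfDegreeOne_apply
    (he : w.asIdeal.ramificationIdx (𝓞 F) = 1) (hf : w.asIdeal.inertiaDeg (𝓞 F) = 1)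
    (y : v.adicCompletion F) :
    adicCompletionHomeomorphOfDegreeOne F K v w he hf y = adicCompletionOfLiesOver F K v w y := rfl

/-- The inverse of the ring isomorphism is the inverse of the homeomorphism (as functions).
[folklore] -/
theorem adicCompletionEquivOfDegreeOne_symm_eq
    (he : w.asIdeal.ramificationIdx (𝓞 F) = 1) (hf : w.asIdeal.inertiaDeg (𝓞 F) = 1) :
    ⇑(adicCompletionEquivOfDegreeOne F K v w he hf).symm =
      (adicCompletionHomeomorphOfDegreeOne F K v w he hf).symm := by
  funext z
  apply (adicCompletionEquivOfDegreeOne F K v w he hf).injective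
  rw [RingEquiv.apply_symm_apply, adicCompletionEquivOfDegreeOne_apply,
    ← adicCompletionHomeomorphOfDegreeOne_apply F K v w he hf, Homeomorph.apply_symm_apply]

/-- `F_v ≃+* K_w` is continuous. [folklore] -/
theorem continuous_adicCompletionEquivOfDegreeOne
    (he : w.asIdeal.ramificationIdx (𝓞 F) = 1) (hf : w.asIdeal.inertiaDeg (𝓞 F) = 1) :
    Continuous (adicCompletionEquivOfDegreeOne F K v w he hf) :=
  continuous_adicCompletionOfLiesOver F K v w

/-- … and so is its inverse. [folklore] -/
theorem continuous_adicCompletionEquivOfDegreeOne_symm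
    (he : w.asIdeal.ramificationIdx (𝓞 F) = 1) (hf : w.asIdeal.inertiaDeg (𝓞 F) = 1) :
    Continuous (adicCompletionEquivOfDegreeOne F K v w he hf).symm := by
  rw [adicCompletionEquivOfDegreeOne_symm_eq]
  exact (adicCompletionHomeomorphOfDegreeOne F K v w he hf).symm.continuous

/-- `F_v ≃+* K_w` preserves valuations. [folklore] -/
theorem valued_adicCompletionEquivOfDegreeOne
    (he : w.asIdeal.ramificationIdx (𝓞 F) = 1) (hf : w.asIdeal.inertiaDeg (𝓞 F) = 1)
    (y : v.adicCompletion F) :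
    Valued.v (adicCompletionEquivOfDegreeOne F K v w he hf y) = Valued.v y :=
  valued_adicCompletionOfLiesOver_of_ramificationIdx_eq_one F K v w he y

/-- … and so does its inverse. [folklore] -/
theorem valued_adicCompletionEquivOfDegreeOne_symm
    (he : w.asIdeal.ramificationIdx (𝓞 F) = 1) (hf : w.asIdeal.inertiaDeg (𝓞 F) = 1)
    (z : w.adicCompletion K) :
    Valued.v ((adicCompletionEquivOfDegreeOne F K v w he hf).symm z) = Valued.v z := by
  conv_rhs => rw [← (adicCompletionEquivOfDegreeOne F K v w he hf).apply_symm_apply z]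
  exact (valued_adicCompletionEquivOfDegreeOne F K v w he hf _).symm

/-- `F_v ≃+* K_w` preserves norms. [folklore] -/
theorem norm_adicCompletionEquivOfDegreeOne
    (he : w.asIdeal.ramificationIdx (𝓞 F) = 1) (hf : w.asIdeal.inertiaDeg (𝓞 F) = 1)
    (y : v.adicCompletion F) :
    ‖adicCompletionEquivOfDegreeOne F K v w he hf y‖ = ‖y‖ :=
  norm_adicCompletionOfLiesOver_of_degree_one F K v w he hf y

/-- … and so does its inverse. [folklore] -/
theorem norm_adicCompletionEquivOfDegreeOne_symm
    (he : w.asIdeal.ramificationIdx (𝓞 F) = 1) (hf : w.asIdeal.inertiaDeg (𝓞 F) = 1)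
    (z : w.adicCompletion K) :
    ‖(adicCompletionEquivOfDegreeOne F K v w he hf).symm z‖ = ‖z‖ := by
  conv_rhs => rw [← (adicCompletionEquivOfDegreeOne F K v w he hf).apply_symm_apply z]
  exact (norm_adicCompletionEquivOfDegreeOne F K v w he hf _).symm

/-- `F_v ≃+* K_w` maps `𝒪_v` onto `𝒪_w`: `e y ∈ 𝒪_w ↔ y ∈ 𝒪_v`. [folklore] -/
theorem mem_adicCompletionIntegers_iff_of_degree_one
    (he : w.asIdeal.ramificationIdx (𝓞 F) = 1) (hf : w.asIdeal.inertiaDeg (𝓞 F) = 1)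
    (y : v.adicCompletion F) :
    adicCompletionEquivOfDegreeOne F K v w he hf y ∈ w.adicCompletionIntegers K ↔
      y ∈ v.adicCompletionIntegers F := by
  rw [HeightOneSpectrum.mem_adicCompletionIntegers, HeightOneSpectrum.mem_adicCompletionIntegers,
    valued_adicCompletionEquivOfDegreeOne]

/-! ### §3 Units: `F_vˣ ≃ₜ* K_wˣ` -/

/-- **`F_vˣ ≃ₜ* K_wˣ` at a place of degree one**: units of `adicCompletionEquivOfDegreeOne`, both
directions continuous for the unit topologies (`Continuous.units_map`). [folklore] -/
def unitsAdicCompletionEquivOfDegreeOne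
    (he : w.asIdeal.ramificationIdx (𝓞 F) = 1) (hf : w.asIdeal.inertiaDeg (𝓞 F) = 1) :
    (v.adicCompletion F)ˣ ≃ₜ* (w.adicCompletion K)ˣ where
  toMulEquiv := Units.mapEquiv (adicCompletionEquivOfDegreeOne F K v w he hf).toMulEquiv
  continuous_toFun :=
    Continuous.units_map (adicCompletionEquivOfDegreeOne F K v w he hf).toMulEquiv.toMonoidHom
      (continuous_adicCompletionEquivOfDegreeOne F K v w he hf)
  continuous_invFun :=
    Continuous.units_map
      (adicCompletionEquivOfDegreeOne F K v w he hf).symm.toMulEquiv.toMonoidHom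
      (continuous_adicCompletionEquivOfDegreeOne_symm F K v w he hf)

/-- Underlying elements: `(e u : K_w) = ι u`. [folklore] -/
@[simp] theorem coe_unitsAdicCompletionEquivOfDegreeOne
    (he : w.asIdeal.ramificationIdx (𝓞 F) = 1) (hf : w.asIdeal.inertiaDeg (𝓞 F) = 1)
    (u : (v.adicCompletion F)ˣ) :
    ((unitsAdicCompletionEquivOfDegreeOne F K v w he hf u : (w.adicCompletion K)ˣ) :
        w.adicCompletion K) = adicCompletionOfLiesOver F K v w (u : v.adicCompletion F) := rfl

/-- Underlying elements of the inverse. [folklore] -/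
@[simp] theorem coe_unitsAdicCompletionEquivOfDegreeOne_symm
    (he : w.asIdeal.ramificationIdx (𝓞 F) = 1) (hf : w.asIdeal.inertiaDeg (𝓞 F) = 1)
    (z : (w.adicCompletion K)ˣ) :
    (((unitsAdicCompletionEquivOfDegreeOne F K v w he hf).symm z : (v.adicCompletion F)ˣ) :
        v.adicCompletion F) =
      (adicCompletionEquivOfDegreeOne F K v w he hf).symm (z : w.adicCompletion K) := rfl

/-- **Unit groups correspond**: `v_w (e u) = 1 ↔ v_v u = 1`, i.e. `e` maps `𝒪_vˣ` onto `𝒪_wˣ`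
(the hyperspecial levels match). [folklore] -/
theorem valued_unitsAdicCompletionEquivOfDegreeOne_eq_one_iff
    (he : w.asIdeal.ramificationIdx (𝓞 F) = 1) (hf : w.asIdeal.inertiaDeg (𝓞 F) = 1)
    (u : (v.adicCompletion F)ˣ) :
    Valued.v ((unitsAdicCompletionEquivOfDegreeOne F K v w he hf u : (w.adicCompletion K)ˣ) :
        w.adicCompletion K) = 1 ↔ Valued.v (u : v.adicCompletion F) = 1 := by
  rw [coe_unitsAdicCompletionEquivOfDegreeOne,
    valued_adicCompletionOfLiesOver_of_ramificationIdx_eq_one F K v w he]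

/-- The same with norms: `‖e u‖ = 1 ↔ ‖u‖ = 1`. [folklore] -/
theorem norm_unitsAdicCompletionEquivOfDegreeOne_eq_one_iff
    (he : w.asIdeal.ramificationIdx (𝓞 F) = 1) (hf : w.asIdeal.inertiaDeg (𝓞 F) = 1)
    (u : (v.adicCompletion F)ˣ) :
    ‖((unitsAdicCompletionEquivOfDegreeOne F K v w he hf u : (w.adicCompletion K)ˣ) :
        w.adicCompletion K)‖ = 1 ↔ ‖(u : v.adicCompletion F)‖ = 1 := by
  rw [coe_unitsAdicCompletionEquivOfDegreeOne,
    norm_adicCompletionOfLiesOver_of_degree_one F K v w he hf]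

end DegreeOne

/-! ### §4 Split places of a quadratic extension have degree one -/

section Quadratic

variable (F : Type*) [Field F] [NumberField F] {E : Type*} [Field E] [NumberField E] [Algebra F E]

/-- **A place moved by an automorphism of a quadratic extension is of degree one**: if `E/F` is
quadratic, `c ∈ Aut(E/F)` and `c • w ≠ w`, then `e(w | w ∩ 𝓞 F) = 1` and `f(w | w ∩ 𝓞 F) = 1` — the
fundamental identity in Galois form `#{𝔓 ∣ v} · e · f = #Aut(E/F) = [E : F] = 2`
(Mathlib `Ideal.ncard_primesOver_mul_ramificationIdxIn_mul_inertiaDegIn`,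
`IsGalois.card_aut_eq_finrank`) with
the two distinct primes `w ≠ c • w` above `v` (`HeightOneSpectrum.under_algEquiv_smul`) —
Fröhlich–Taylor III §1 Theorem 20, `(L:K) = efg` with `g ≥ 2`, `(L:K) = 2`.
[cite: FrohlichTaylor1990, Ch. III §1 Thm. 20] -/
theorem ramificationIdx_eq_one_and_inertiaDeg_eq_one_of_smul_ne [Algebra.IsQuadraticExtension F E]
    (c : E ≃ₐ[F] E) {w : HeightOneSpectrum (𝓞 E)} (hw : c • w ≠ w) :
    w.asIdeal.ramificationIdx (𝓞 F) = 1 ∧ w.asIdeal.inertiaDeg (𝓞 F) = 1 := by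
  set p : Ideal (𝓞 F) := (w.under (𝓞 F)).asIdeal with hp
  haveI : p.IsMaximal := (w.under (𝓞 F)).isMaximal
  haveI : w.asIdeal.LiesOver p := ⟨rfl⟩
  haveI : (c • w).asIdeal.LiesOver p :=
    ⟨congrArg HeightOneSpectrum.asIdeal (HeightOneSpectrum.under_algEquiv_smul F E c w).symm⟩
  haveI : IsGaloisGroup (E ≃ₐ[F] E) (𝓞 F) (𝓞 E) := IsGaloisGroup.of_isFractionRing _ _ _ F E
  have hid := Ideal.ncard_primesOver_mul_ramificationIdxIn_mul_inertiaDegIn p (𝓞 E) (E ≃ₐ[F] E)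
  have hcard : Nat.card (E ≃ₐ[F] E) = 2 :=
    (Algebra.IsQuadraticExtension.finrank_eq_two F E) ▸ IsGalois.card_aut_eq_finrank F E
  rw [hcard, Ideal.ramificationIdxIn_eq_ramificationIdx p w.asIdeal (E ≃ₐ[F] E),
    Ideal.inertiaDegIn_eq_inertiaDeg p w.asIdeal (E ≃ₐ[F] E)] at hid
  have hne : w.asIdeal ≠ (c • w).asIdeal := fun h => hw (HeightOneSpectrum.ext h.symm)
  have h2le : 2 ≤ (p.primesOver (𝓞 E)).ncard := by
    have hsub : ({w.asIdeal, (c • w).asIdeal} : Set (Ideal (𝓞 E))) ⊆ p.primesOver (𝓞 E) := by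
      rintro P (rfl | rfl)
      · exact ⟨w.isPrime, inferInstance⟩
      · exact ⟨(c • w).isPrime, inferInstance⟩
    calc 2 = ({w.asIdeal, (c • w).asIdeal} : Set (Ideal (𝓞 E))).ncard := (Set.ncard_pair hne).symm
      _ ≤ (p.primesOver (𝓞 E)).ncard :=
          Set.ncard_le_ncard hsub (IsDedekindDomain.primesOver_finite p (𝓞 E))
  set m := w.asIdeal.ramificationIdx (𝓞 F) * w.asIdeal.inertiaDeg (𝓞 F) with hm
  have hm1 : m = 1 := by
    have hm0 : m ≠ 0 := fun h => by rw [h, mul_zero] at hid; exact absurd hid (by norm_num)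
    have hle : m ≤ 1 := by
      by_contra hcon
      have : 2 * 2 ≤ (p.primesOver (𝓞 E)).ncard * m := Nat.mul_le_mul h2le (by omega)
      omega
    omega
  exact mul_eq_one.1 hm1

/-- `e(w | w ∩ 𝓞 F) = 1` at a place moved by `c`, in Mathlib's `Ideal.ramificationIdx'` form (the
one carried by `valued_adicCompletionOfLiesOver`). [folklore] -/
theorem ramificationIdx'_eq_one_of_smul_ne [Algebra.IsQuadraticExtension F E] (c : E ≃ₐ[F] E)
    {w : HeightOneSpectrum (𝓞 E)} (hw : c • w ≠ w) :
    (w.under (𝓞 F)).asIdeal.ramificationIdx' w.asIdeal = 1 := by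
  haveI : w.asIdeal.LiesOver (w.under (𝓞 F)).asIdeal := ⟨rfl⟩
  rw [Ideal.ramificationIdx'_eq_ramificationIdx _ _ (w.under (𝓞 F)).ne_bot]
  exact (ramificationIdx_eq_one_and_inertiaDeg_eq_one_of_smul_ne F c hw).1

/-- **Equal residue cardinalities at a split place of a quadratic extension**: `q_w = q_v`.
[folklore] -/
theorem absNorm_eq_absNorm_under_of_smul_ne [Algebra.IsQuadraticExtension F E] (c : E ≃ₐ[F] E)
    {w : HeightOneSpectrum (𝓞 E)} (hw : c • w ≠ w) :
    Ideal.absNorm w.asIdeal = Ideal.absNorm (w.under (𝓞 F)).asIdeal :=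
  @absNorm_eq_absNorm_of_inertiaDeg_eq_one F E _ _ _ _ (w.under (𝓞 F)) w ⟨rfl⟩ _
    (ramificationIdx_eq_one_and_inertiaDeg_eq_one_of_smul_ne F c hw).2

end Quadratic

end Literature.NumberTheory.Automorphic

end
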